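import Summits.AtomisticToContinuum.FouriersLaw.Theorems.BondHeatUncertaintySubdiffusiveBondHeatJunctionGradedCalibration

/-!
# Calibration of the ratio ladder: `2^s = 2ρ` is sharp, no Ohmic kernel at `ρ → 1⁻`, and `ρ = 1` is not necessary

Companion (pure sequence analysis; imports file (12) only, independent of `…JunctionRatioLadder`) for stmt-AtomisticToContinuum-11071,
cell `decomp-a2c`, lens-1 (grading / quantitative ladder), gen 58 — file (14).  Three witnesses fix the grades claimed in
`…JunctionRatioLadder` (the ratio ladder `SeriesRatioLaw ρ` of the escape resistances `r_N = 1/E_N(T)`):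
* §A `r_N = N^s` (`0 < s ≤ 1`): obeys the ratio law `(2^s/2)·(r_u + r_v) ≤ r_{u+L₀+v}` for all `u, v ≥ 1` and EVERY buffer and beats no
  exponent `s' > s` — the dictionary «`SeriesRatioLaw ρ ⟹ ExponentFloor s`, `2^s = 2ρ`» is SHARP (`ratio_powerMean`, `ratioJunction_sharp`,
  `not_rpow_kernel_above`);
* §B `r_N = N/log N`: `≥ 1`, obeys the ratio law for EVERY `ρ < 1` beyond a threshold `N₂(ρ)`, and lies below every linear floor — NO
  kernel turns `AsymptoticSeriesLaw` (with `0 < E_N ≤ 1`) into the Ohmic floor (`div_log_witness`, `not_linear_kernel_of_asymptoticRatio`):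
  the necessary part of the ladder stops strictly short of 11071, and the gap is exactly a slowly varying (logarithmic) correction;
* §C `r_N = N + √N`: Fourier-type asymptotics `r_N/N → 1` and every ratio law `ρ < 1` across every buffer, yet the buffered series
  inequality `r_u + r_v − C ≤ r_{u+L₀+v}` fails for ALL `C, L₀, N₂` (`sqrt_witness`, `not_bufferedSeries_of_asymptoticRatio`): the sufficient
  rung `ρ = 1` (`BufferedSeriesLaw` / `BufferedJunctionLaw`) is not forced by the necessary data — it is a mechanism to be proved from the
  dynamics, not a consequence of the conjecture.
No `sorry`; standard axioms; nothing here closes an item.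
-/

noncomputable section

open MeasureTheory Filter Topology Set
open scoped BigOperators

namespace Summit.AtomisticToContinuum.FouriersLaw.Theorems.SubdiffusiveBondHeat

namespace EscapeGrading

/-! ## A. Rung-wise sharpness: `r_N = N^s` obeys the ratio law with `ρ = 2^s/2` and has no better exponent -/

/-- Power-mean inequality (concavity of `x ↦ x^s`, `0 < s ≤ 1`): `(2^s/2)·(a^s + b^s) ≤ (a + b)^s` for `a, b ≥ 0`. [folklore] -/
theorem ratio_powerMean {s : ℝ} (hs0 : 0 < s) (hs1 : s ≤ 1) {a b : ℝ} (ha : 0 ≤ a) (hb : 0 ≤ b) :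
    (2 : ℝ) ^ s / 2 * (a ^ s + b ^ s) ≤ (a + b) ^ s := by
  have hp : 1 ≤ s⁻¹ := (one_le_inv₀ hs0).2 hs1
  have hx : 0 ≤ a ^ s := Real.rpow_nonneg ha s
  have hy : 0 ≤ b ^ s := Real.rpow_nonneg hb s
  have hconv := (convexOn_rpow hp).2 (Set.mem_Ici.2 hx) (Set.mem_Ici.2 hy) (by norm_num : (0 : ℝ) ≤ 1 / 2)
    (by norm_num : (0 : ℝ) ≤ 1 / 2) (by norm_num)
  simp only [smul_eq_mul] at hconv
  rw [Real.rpow_rpow_inv ha hs0.ne', Real.rpow_rpow_inv hb hs0.ne'] at hconv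
  have hz : 0 ≤ 1 / 2 * a ^ s + 1 / 2 * b ^ s := by positivity
  have h2 : 1 / 2 * a ^ s + 1 / 2 * b ^ s ≤ (1 / 2 * a + 1 / 2 * b) ^ s :=
    calc 1 / 2 * a ^ s + 1 / 2 * b ^ s = ((1 / 2 * a ^ s + 1 / 2 * b ^ s) ^ s⁻¹) ^ s :=
          (Real.rpow_inv_rpow hz hs0.ne').symm
      _ ≤ (1 / 2 * a + 1 / 2 * b) ^ s := Real.rpow_le_rpow (Real.rpow_nonneg hz _) hconv hs0.le
  have h3 : (1 / 2 * a + 1 / 2 * b) ^ s = (a + b) ^ s / (2 : ℝ) ^ s := by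
    rw [show 1 / 2 * a + 1 / 2 * b = (a + b) / 2 by ring, Real.div_rpow (by positivity) (by norm_num)]
  rw [h3, le_div_iff₀ (Real.rpow_pos_of_pos two_pos s)] at h2
  nlinarith [h2, Real.rpow_pos_of_pos two_pos s]

/-- **Sharpness of the dictionary `2^s = 2ρ`.**  For `0 < s ≤ 1` the sequence `r_N = N^s` is `≥ 1` from `N = 1` on, obeys the ratio law
`(2^s/2)·(r_u + r_v) ≤ r_{u+L₀+v}` for ALL `u, v ≥ 1` and EVERY buffer `L₀`, and beats no exponent `s' > s`: the conclusion of
`rpow_of_ratioJunction` cannot be improved. [folklore] -/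
theorem ratioJunction_sharp {s : ℝ} (hs0 : 0 < s) (hs1 : s ≤ 1) :
    ∃ r : ℕ → ℝ, (∀ n : ℕ, 1 ≤ n → 1 ≤ r n) ∧
      (∀ L₀ u v : ℕ, 1 ≤ u → 1 ≤ v → (2 : ℝ) ^ s / 2 * (r u + r v) ≤ r (u + L₀ + v)) ∧
      ∀ s' : ℝ, s < s' → ∀ c : ℝ, 0 < c → ∀ N₀ : ℕ, ∃ N : ℕ, N₀ ≤ N ∧ r N < c * (N : ℝ) ^ s' := by
  refine ⟨fun n => (n : ℝ) ^ s, fun n hn => Real.one_le_rpow (by exact_mod_cast hn) hs0.le, fun L₀ u v hu hv => ?_,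
    fun s' hss' c hc N₀ => ?_⟩
  · have hu0 : (0 : ℝ) ≤ u := Nat.cast_nonneg u
    have hv0 : (0 : ℝ) ≤ v := Nat.cast_nonneg v
    calc (2 : ℝ) ^ s / 2 * ((u : ℝ) ^ s + (v : ℝ) ^ s) ≤ ((u : ℝ) + v) ^ s := ratio_powerMean hs0 hs1 hu0 hv0
      _ ≤ (((u + L₀ + v : ℕ) : ℝ)) ^ s := by
          refine Real.rpow_le_rpow (by positivity) ?_ hs0.le
          push_cast
          linarith [(Nat.cast_nonneg L₀ : (0 : ℝ) ≤ L₀)]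
  · -- `N^{s'-s} → ∞`: pick `N ≥ max N₀ 1` with `1/c < N^{s'-s}`
    have hlim : Tendsto (fun N : ℕ => ((N : ℝ)) ^ (s' - s)) atTop atTop :=
      (tendsto_rpow_atTop (by linarith)).comp tendsto_natCast_atTop_atTop
    obtain ⟨N₁, hN₁⟩ := eventually_atTop.1 (hlim.eventually_gt_atTop (1 / c))
    refine ⟨max (max N₀ 1) N₁, le_trans (le_max_left _ _) (le_max_left _ _), ?_⟩
    set N := max (max N₀ 1) N₁ with hN
    have hNpos : (0 : ℝ) < N := by exact_mod_cast lt_of_lt_of_le one_pos (le_trans (le_max_right N₀ 1) (le_max_left _ _))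
    have hgt : 1 / c < (N : ℝ) ^ (s' - s) := hN₁ N (le_max_right _ _)
    have hsplit : (N : ℝ) ^ s' = (N : ℝ) ^ (s' - s) * (N : ℝ) ^ s := by
      rw [← Real.rpow_add hNpos]; ring_nf
    rw [hsplit]
    have hNs : 0 < (N : ℝ) ^ s := Real.rpow_pos_of_pos hNpos s
    have h1 : 1 < c * (N : ℝ) ^ (s' - s) := by
      have h := mul_lt_mul_of_pos_left hgt hc
      rwa [mul_one_div_cancel hc.ne'] at h
    nlinarith [mul_lt_mul_of_pos_right h1 hNs]

/-- **Corollary: no kernel improves the exponent.**  For `0 < s ≤ 1 `, `s < s'`, the statement «`r ≥ 1`, ratio law with `ρ = 2^s/2` across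
some buffer ⟹ `r_N ≥ c·N^{s'}` eventually» is FALSE. [folklore] -/
theorem not_rpow_kernel_above {s s' : ℝ} (hs0 : 0 < s) (hs1 : s ≤ 1) (hss' : s < s') :
    ¬ ∀ (r : ℕ → ℝ) (L₀ N₂ : ℕ), 1 ≤ N₂ → (∀ n : ℕ, N₂ ≤ n → 1 ≤ r n) →
      (∀ u v : ℕ, N₂ ≤ u → N₂ ≤ v → (2 : ℝ) ^ s / 2 * (r u + r v) ≤ r (u + L₀ + v)) →
      ∃ c : ℝ, 0 < c ∧ ∃ N₀ : ℕ, ∀ N : ℕ, N₀ ≤ N → c * (N : ℝ) ^ s' ≤ r N := by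
  intro h
  obtain ⟨r, h1, hJ, hfail⟩ := ratioJunction_sharp hs0 hs1
  obtain ⟨c, hc, N₀, hfl⟩ := h r 0 1 le_rfl h1 (fun u v hu hv => hJ 0 u v hu hv)
  obtain ⟨N, hN, hlt⟩ := hfail s' hss' c hc N₀
  exact absurd (hfl N hN) (not_le.2 hlt)

/-! ## B. The top of the necessary part has no Ohmic kernel: `r_N = N / log N` -/

/-- `x ↦ x / log x` is monotone on `[3, ∞)` (from Mathlib's `Real.log_div_self_antitoneOn` on `[e, ∞)`). [folklore] -/
theorem div_log_mono {x y : ℝ} (hx : 3 ≤ x) (hxy : x ≤ y) : x / Real.log x ≤ y / Real.log y := by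
  have he : Real.exp 1 ≤ 3 := by
    have := Real.exp_one_lt_d9
    linarith
  have hxe : Real.exp 1 ≤ x := le_trans he hx
  have hye : Real.exp 1 ≤ y := le_trans hxe hxy
  have hanti := Real.log_div_self_antitoneOn hxe hye hxy
  -- `log y / y ≤ log x / x`, both logs positive
  have hlx : 0 < Real.log x := Real.log_pos (by linarith)
  have hly : 0 < Real.log y := Real.log_pos (by linarith)
  have hx0 : 0 < x := by linarith
  have hy0 : 0 < y := by linarith
  rw [div_le_div_iff₀ hlx hly]
  have h := hanti
  simp only at h
  rw [div_le_div_iff₀ hy0 hx0] at h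
  linarith

/-- `1 ≤ n / log n` for `n ≥ 3` (`log n ≤ n − 1`). [folklore] -/
theorem one_le_div_log {n : ℕ} (hn : 3 ≤ n) : 1 ≤ (n : ℝ) / Real.log n := by
  have hn' : (3 : ℝ) ≤ n := by exact_mod_cast hn
  have hlog : 0 < Real.log n := Real.log_pos (by linarith)
  rw [one_le_div hlog]
  linarith [Real.log_le_sub_one_of_pos (show (0 : ℝ) < n by linarith)]

/-- **The core estimate.**  For `0 < ρ < 1` there is a threshold beyond which `ρ·(u/log u + v/log v) ≤ (u+v)/log(u+v)` whenever
`v ≤ u`.  With `ρ₁ = (1+ρ)/2`: `log(u+v) ≤ log 2 + log u ≤ log u/ρ₁` for `u` large, so `(u+v)/log(u+v) ≥ ρ₁(u+v)/log u`; if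
`ρ·log u ≤ ρ₁·log v` this already dominates `ρ u/log u + ρ v/log v`; otherwise `v < u^q`, `q = ρ/ρ₁ < 1`, and `v/log v ≤ v ≤ u^q ≤
((1−ρ)/ρ)·u/log u` for `u` large (`log u = o(u^{1−q})`). [folklore] -/
theorem div_log_ratio_core {ρ : ℝ} (hρ0 : 0 < ρ) (hρ1 : ρ < 1) :
    ∃ N₂ : ℕ, 3 ≤ N₂ ∧ ∀ u v : ℕ, N₂ ≤ u → N₂ ≤ v → v ≤ u →
      ρ * ((u : ℝ) / Real.log u + (v : ℝ) / Real.log v) ≤ ((u : ℝ) + v) / Real.log ((u : ℝ) + v) := by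
  -- constants
  obtain ⟨ρ₁, hρ₁⟩ : ∃ ρ₁ : ℝ, ρ₁ = (1 + ρ) / 2 := ⟨_, rfl⟩
  have hρ₁ρ : ρ < ρ₁ := by rw [hρ₁]; linarith
  have hρ₁1 : ρ₁ < 1 := by rw [hρ₁]; linarith
  have hρ₁0 : 0 < ρ₁ := by linarith
  obtain ⟨q, hq⟩ : ∃ q : ℝ, q = ρ / ρ₁ := ⟨_, rfl⟩
  have hq0 : 0 < q := by rw [hq]; positivity
  have hq1 : q < 1 := by rw [hq, div_lt_one hρ₁0]; exact hρ₁ρ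
  -- threshold A: `log 2 ≤ (1/ρ₁ − 1)·log u`, i.e. `log 2 + log u ≤ log u / ρ₁`
  have hlimlog : Tendsto (fun N : ℕ => Real.log (N : ℝ)) atTop atTop :=
    Real.tendsto_log_atTop.comp tendsto_natCast_atTop_atTop
  obtain ⟨A, hA⟩ := eventually_atTop.1 (hlimlog.eventually_ge_atTop (Real.log 2 / (1 / ρ₁ - 1)))
  -- threshold B: `ρ·log u ≤ (1 − ρ)·u^{1−q}` eventually (`log = o(x^{1−q})`)
  have hc : 0 < (1 - ρ) / ρ := by
    have : 0 < 1 - ρ := by linarith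
    positivity
  have hB' : ∀ᶠ x : ℝ in atTop, ‖Real.log x‖ ≤ (1 - ρ) / ρ * ‖x ^ (1 - q)‖ :=
    (isLittleO_log_rpow_atTop (by linarith : 0 < 1 - q)).bound hc
  obtain ⟨B, hB⟩ := eventually_atTop.1 (tendsto_natCast_atTop_atTop.eventually hB')
  refine ⟨max 3 (max A B), le_max_left _ _, fun u v hu hv hvu => ?_⟩
  have hu3 : (3 : ℝ) ≤ u := by exact_mod_cast le_trans (le_max_left _ _) hu
  have hv3 : (3 : ℝ) ≤ v := by exact_mod_cast le_trans (le_max_left _ _) hv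
  have huA : A ≤ u := le_trans (le_trans (le_max_left _ _) (le_max_right _ _)) hu
  have huB : B ≤ u := le_trans (le_trans (le_max_right _ _) (le_max_right _ _)) hu
  have hvuR : (v : ℝ) ≤ u := by exact_mod_cast hvu
  have hu0 : (0 : ℝ) < u := by linarith
  have hv0 : (0 : ℝ) < v := by linarith
  have hlu : 0 < Real.log u := Real.log_pos (by linarith)
  have hlv : 0 < Real.log v := Real.log_pos (by linarith)
  have hlv1 : 1 ≤ Real.log v := by
    -- `log v ≥ log 3 > 1`
    have h3 : Real.log 3 ≤ Real.log v := Real.log_le_log (by norm_num) hv3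
    have he : Real.exp 1 ≤ 3 := by have := Real.exp_one_lt_d9; linarith
    have h1 : (1 : ℝ) ≤ Real.log 3 := by
      rw [← Real.log_exp 1]
      exact Real.log_le_log (Real.exp_pos 1) he
    linarith
  have hluv : 0 < Real.log ((u : ℝ) + v) := Real.log_pos (by linarith)
  -- (I) `log(u+v) ≤ log u / ρ₁`
  have hI : Real.log ((u : ℝ) + v) ≤ Real.log u / ρ₁ := by
    have h2u : Real.log ((u : ℝ) + v) ≤ Real.log 2 + Real.log u := by
      rw [← Real.log_mul (by norm_num) hu0.ne']
      exact Real.log_le_log (by linarith) (by linarith)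
    have hAu : Real.log 2 / (1 / ρ₁ - 1) ≤ Real.log u := hA u huA
    have hden : 0 < 1 / ρ₁ - 1 := by
      rw [sub_pos, lt_one_div (by norm_num : (0:ℝ) < 1) hρ₁0] ; simpa using hρ₁1
    rw [div_le_iff₀ hden] at hAu
    have e : Real.log u / ρ₁ = Real.log u + Real.log u * (1 / ρ₁ - 1) := by
      field_simp
      ring
    rw [e]
    linarith
  -- hence `ρ₁ (u+v)/log u ≤ (u+v)/log(u+v)`
  have hI' : ρ₁ * (((u : ℝ) + v) / Real.log u) ≤ ((u : ℝ) + v) / Real.log ((u : ℝ) + v) := by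
    rw [← mul_div_assoc, div_le_div_iff₀ hlu hluv]
    have h := mul_le_mul_of_nonneg_left hI (show 0 ≤ ρ₁ * ((u : ℝ) + v) by positivity)
    have e : ρ₁ * ((u : ℝ) + v) * (Real.log u / ρ₁) = ((u : ℝ) + v) * Real.log u := by
      field_simp
    linarith [e ▸ h]
  -- two cases on the size of `v`
  rcases le_or_gt (ρ * Real.log u) (ρ₁ * Real.log v) with hcase | hcase
  · -- Case A: `ρ/log v ≤ ρ₁/log u` termwise
    refine le_trans ?_ hI'
    have h1 : ρ * ((u : ℝ) / Real.log u) ≤ ρ₁ * ((u : ℝ) / Real.log u) :=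
      mul_le_mul_of_nonneg_right hρ₁ρ.le (by positivity)
    have h2 : ρ * ((v : ℝ) / Real.log v) ≤ ρ₁ * ((v : ℝ) / Real.log u) := by
      rw [← mul_div_assoc, ← mul_div_assoc, div_le_div_iff₀ hlv hlu]
      nlinarith [mul_le_mul_of_nonneg_left hcase hv0.le]
    calc ρ * ((u : ℝ) / Real.log u + (v : ℝ) / Real.log v)
        = ρ * ((u : ℝ) / Real.log u) + ρ * ((v : ℝ) / Real.log v) := by ring
      _ ≤ ρ₁ * ((u : ℝ) / Real.log u) + ρ₁ * ((v : ℝ) / Real.log u) := add_le_add h1 h2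
      _ = ρ₁ * (((u : ℝ) + v) / Real.log u) := by rw [add_div]; ring
  · -- Case B: `v < u^q`; then `ρ v/log v ≤ ρ u^q ≤ (1 − ρ) u/log u`... and `ρ₁ (u+v)/log u ≥ ρ₁ u/log u ≥ u/log u · ρ + (ρ₁-ρ) u/log u`
    have hvq : (v : ℝ) < (u : ℝ) ^ q := by
      have hlogv : Real.log v < q * Real.log u := by
        rw [hq, div_mul_eq_mul_div, lt_div_iff₀ hρ₁0]
        linarith
      calc (v : ℝ) = Real.exp (Real.log v) := (Real.exp_log hv0).symm
        _ < Real.exp (q * Real.log u) := Real.exp_lt_exp.2 hlogv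
        _ = (u : ℝ) ^ q := by rw [Real.rpow_def_of_pos hu0, mul_comm]
    -- `v/log v ≤ v` (log v ≥ 1)
    have hfv : (v : ℝ) / Real.log v ≤ v := div_le_self hv0.le hlv1
    -- threshold B: `ρ log u ≤ (1-ρ) u^{1-q}`
    have hBu := hB u huB
    rw [Real.norm_of_nonneg hlu.le, Real.norm_of_nonneg (Real.rpow_nonneg hu0.le _)] at hBu
    -- `u^q · u^{1−q} = u`
    have hsplit : (u : ℝ) ^ q * (u : ℝ) ^ (1 - q) = u := by
      rw [← Real.rpow_add hu0]; norm_num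
    have huq0 : 0 < (u : ℝ) ^ q := Real.rpow_pos_of_pos hu0 q
    -- `ρ u^q ≤ (1 − ρ) u / log u`
    have hkey : ρ * (u : ℝ) ^ q ≤ (1 - ρ) * ((u : ℝ) / Real.log u) := by
      rw [← mul_div_assoc, le_div_iff₀ hlu]
      -- `ρ u^q log u ≤ ρ u^q · ((1-ρ)/ρ) u^{1-q} = (1-ρ) u`
      have h := mul_le_mul_of_nonneg_left hBu (show 0 ≤ ρ * (u : ℝ) ^ q by positivity)
      have e : ρ * (u : ℝ) ^ q * ((1 - ρ) / ρ * (u : ℝ) ^ (1 - q)) = (1 - ρ) * ((u : ℝ) ^ q * (u : ℝ) ^ (1 - q)) := by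
        field_simp
      rw [e, hsplit] at h
      linarith
    calc ρ * ((u : ℝ) / Real.log u + (v : ℝ) / Real.log v)
        ≤ ρ * ((u : ℝ) / Real.log u) + ρ * (u : ℝ) ^ q := by
          rw [mul_add]; exact add_le_add le_rfl (mul_le_mul_of_nonneg_left (by linarith) hρ0.le)
      _ ≤ ρ * ((u : ℝ) / Real.log u) + (1 - ρ) * ((u : ℝ) / Real.log u) := add_le_add le_rfl hkey
      _ = (u : ℝ) / Real.log u := by ring
      _ ≤ ((u : ℝ) + v) / Real.log ((u : ℝ) + v) := div_log_mono hu3 (by linarith)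

/-- `N / log N` lies below every linear floor infinitely often (indeed eventually). [folklore] -/
theorem div_log_not_linear (a : ℝ) (ha : 0 < a) (N₀ : ℕ) : ∃ N : ℕ, N₀ ≤ N ∧ (N : ℝ) / Real.log N < a * N := by
  obtain ⟨P, hP⟩ := exists_nat_ge (Real.exp (1 / a) + 3)
  refine ⟨max N₀ P, le_max_left _ _, ?_⟩
  set N := max N₀ P with hN
  have hNP : Real.exp (1 / a) + 3 ≤ N := le_trans hP (by exact_mod_cast le_max_right N₀ P)
  have hN0 : (0 : ℝ) < N := by linarith [Real.exp_pos (1 / a)]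
  have hlog : 1 / a < Real.log N := by
    have h := Real.log_lt_log (Real.exp_pos _) (show Real.exp (1 / a) < N by linarith)
    rwa [Real.log_exp] at h
  have hlogpos : 0 < Real.log N := lt_trans (by positivity) hlog
  rw [div_lt_iff₀ hlogpos]
  have h1 : 1 < a * Real.log N := by
    have h := mul_lt_mul_of_pos_left hlog ha
    rwa [mul_one_div_cancel ha.ne'] at h
  nlinarith [mul_lt_mul_of_pos_left h1 hN0]

/-- **THE TOP WITNESS `r_N = N / log N`.**  It is `≥ 1` (from `N = 3`), obeys the ratio law `ρ·(r_u + r_v) ≤ r_{u+v}` beyond a threshold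
`N₂(ρ)` for EVERY `ρ < 1` (no buffer needed), and lies below every linear floor `a·N` cofinally: the hypotheses of the ratio kernel for ALL
`ρ < 1` simultaneously do NOT give linear growth — `AsymptoticSeriesLaw` delivers every `F(s)`, `s < 1`, and provably not `F(1)` by this
road. [folklore] -/
theorem div_log_witness :
    (∀ n : ℕ, 3 ≤ n → 1 ≤ (n : ℝ) / Real.log n) ∧
    (∀ ρ : ℝ, ρ < 1 → ∃ N₂ : ℕ, 3 ≤ N₂ ∧ ∀ u v : ℕ, N₂ ≤ u → N₂ ≤ v →
        ρ * ((u : ℝ) / Real.log u + (v : ℝ) / Real.log v)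
          ≤ ((u + 0 + v : ℕ) : ℝ) / Real.log ((u + 0 + v : ℕ) : ℝ)) ∧
    (∀ a : ℝ, 0 < a → ∀ N₀ : ℕ, ∃ N : ℕ, N₀ ≤ N ∧ (N : ℝ) / Real.log N < a * N) := by
  refine ⟨fun n hn => one_le_div_log hn, fun ρ hρ1 => ?_, fun a ha N₀ => div_log_not_linear a ha N₀⟩
  have hcast : ∀ u v : ℕ, (((u + 0 + v : ℕ) : ℝ)) = (u : ℝ) + v := fun u v => by push_cast; ring
  rcases le_or_gt ρ 0 with hρ0 | hρ0
  · refine ⟨3, le_rfl, fun u v hu hv => ?_⟩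
    rw [hcast]
    have hu3 : (3 : ℝ) ≤ u := by exact_mod_cast hu
    have hv3 : (3 : ℝ) ≤ v := by exact_mod_cast hv
    have h1 : 0 ≤ (u : ℝ) / Real.log u := div_nonneg (by linarith) (Real.log_nonneg (by linarith))
    have h2 : 0 ≤ (v : ℝ) / Real.log v := div_nonneg (by linarith) (Real.log_nonneg (by linarith))
    have h3 : 0 ≤ ((u : ℝ) + v) / Real.log ((u : ℝ) + v) := div_nonneg (by linarith) (Real.log_nonneg (by linarith))
    nlinarith [mul_nonpos_of_nonpos_of_nonneg hρ0 (add_nonneg h1 h2)]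
  · obtain ⟨N₂, hN₂3, hcore⟩ := div_log_ratio_core hρ0 hρ1
    refine ⟨N₂, hN₂3, fun u v hu hv => ?_⟩
    rw [hcast]
    rcases le_total v u with hvu | huv
    · exact hcore u v hu hv hvu
    · have h := hcore v u hv hu huv
      rw [add_comm ((v : ℝ) / Real.log v), add_comm (v : ℝ)] at h
      exact h

/-- **Corollary: no Ohmic kernel at `ρ → 1⁻`.**  The statement «`r ≥ 1` beyond a threshold and, for EVERY `ρ < 1`, a ratio law
`ρ·(r_u + r_v) ≤ r_{u+L₀+v}` beyond a threshold ⟹ `r_N ≥ a·N` eventually for some `a > 0`» is FALSE (`r_N = N/log N`).  This is the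
exact sense in which the necessary part of the ratio ladder (`AsymptoticSeriesLaw`) stops short of the blocker `F(1)` ⟺ 11071: the last
step needs an input that is not a ratio law — an ABSOLUTE defect law (`BufferedJunctionLaw`) or the bootstrap `SubOhmicBootstrap`. [folklore] -/
theorem not_linear_kernel_of_asymptoticRatio :
    ¬ ∀ (r : ℕ → ℝ) (N₁ : ℕ), (∀ n : ℕ, N₁ ≤ n → 1 ≤ r n) →
      (∀ ρ : ℝ, ρ < 1 → ∃ L₀ N₂ : ℕ, ∀ u v : ℕ, N₂ ≤ u → N₂ ≤ v → ρ * (r u + r v) ≤ r (u + L₀ + v)) →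
      ∃ a : ℝ, 0 < a ∧ ∃ N₀ : ℕ, ∀ N : ℕ, N₀ ≤ N → a * (N : ℝ) ≤ r N := by
  intro h
  obtain ⟨h1, hlaw, hfail⟩ := div_log_witness
  obtain ⟨a, ha, N₀, hfl⟩ := h (fun n => (n : ℝ) / Real.log n) 3 h1 (fun ρ hρ => by
    obtain ⟨N₂, -, hN₂⟩ := hlaw ρ hρ
    exact ⟨0, N₂, hN₂⟩)
  obtain ⟨N, hN, hlt⟩ := hfail a ha N₀
  exact absurd (hfl N hN) (not_le.2 hlt)

/-! ## C. The sufficient rung `ρ = 1` is not necessary: `r_N = N + √N` -/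

/-- **THE WITNESS `r_N = N + √N`**: Fourier-type asymptotics `r_N/N → 1`, every ratio law `ρ < 1` across EVERY buffer, yet the buffered
series inequality `r_u + r_v − C ≤ r_{u+L₀+v}` FAILS for every `C`, `L₀`, `N₂` (at `u = v = n²`: `2n > C + L₀ + √(2n² + L₀)`).  So the
necessary information (conductivity exists + `AsymptoticSeriesLaw`) does not imply `BufferedSeriesLaw`/`BufferedJunctionLaw` at sequence
level: the `ρ = 1` rung is a MECHANISM, not a consequence of the conjecture. [folklore] -/
theorem sqrt_witness :
    Tendsto (fun N : ℕ => ((N : ℝ) + Real.sqrt N) / N) atTop (𝓝 1) ∧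
    (∀ ρ : ℝ, ρ < 1 → ∃ N₂ : ℕ, ∀ L₀ u v : ℕ, N₂ ≤ u → N₂ ≤ v →
        ρ * (((u : ℝ) + Real.sqrt u) + ((v : ℝ) + Real.sqrt v))
          ≤ ((u + L₀ + v : ℕ) : ℝ) + Real.sqrt ((u + L₀ + v : ℕ) : ℝ)) ∧
    (∀ (C : ℝ) (L₀ N₂ : ℕ), ∃ u v : ℕ, N₂ ≤ u ∧ N₂ ≤ v ∧
        ((u + L₀ + v : ℕ) : ℝ) + Real.sqrt ((u + L₀ + v : ℕ) : ℝ) < ((u : ℝ) + Real.sqrt u) + ((v : ℝ) + Real.sqrt v) - C) := by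
  refine ⟨?_, fun ρ hρ1 => ?_, fun C L₀ N₂ => ?_⟩
  · -- `(N + √N)/N = 1 + N^{-1/2}` for `N > 0`
    have hlim : Tendsto (fun N : ℕ => 1 + ((N : ℝ)) ^ (-(1 / 2 : ℝ))) atTop (𝓝 1) := by
      have h := (tendsto_rpow_neg_atTop (by norm_num : (0 : ℝ) < 1 / 2)).comp tendsto_natCast_atTop_atTop
      simpa using tendsto_const_nhds.add h
    refine hlim.congr' ?_
    filter_upwards [eventually_gt_atTop 0] with N hN
    have hN0 : (0 : ℝ) < N := by exact_mod_cast hN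
    have hs : 0 < Real.sqrt N := Real.sqrt_pos.2 hN0
    rw [Real.rpow_neg hN0.le, ← Real.sqrt_eq_rpow, add_div, div_self hN0.ne']
    congr 1
    rw [inv_eq_one_div, div_eq_div_iff hs.ne' hN0.ne', one_mul, Real.mul_self_sqrt hN0.le]
  · rcases le_or_gt ρ 0 with hρ0 | hρ0
    · refine ⟨0, fun L₀ u v _ _ => ?_⟩
      have h1 : 0 ≤ ((u : ℝ) + Real.sqrt u) + ((v : ℝ) + Real.sqrt v) := by positivity
      have h2 : 0 ≤ ((u + L₀ + v : ℕ) : ℝ) + Real.sqrt ((u + L₀ + v : ℕ) : ℝ) := by positivity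
      nlinarith [mul_nonpos_of_nonpos_of_nonneg hρ0 h1]
    · -- threshold: `√u ≤ ((1-ρ)/ρ)·u` once `u ≥ (ρ/(1-ρ))²`
      obtain ⟨k, hk⟩ : ∃ k : ℝ, k = (1 - ρ) / ρ := ⟨_, rfl⟩
      have hk0 : 0 < k := by rw [hk]; exact div_pos (by linarith) hρ0
      obtain ⟨N₂, hN₂⟩ := exists_nat_ge (1 / k ^ 2)
      have hroot : ∀ u : ℕ, N₂ ≤ u → Real.sqrt u ≤ k * u := by
        intro u hu
        have huR : 1 / k ^ 2 ≤ (u : ℝ) := le_trans hN₂ (by exact_mod_cast hu)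
        have hu0 : (0 : ℝ) ≤ u := Nat.cast_nonneg u
        rw [Real.sqrt_le_iff]
        refine ⟨by positivity, ?_⟩
        have h1 : 1 ≤ k ^ 2 * u := by
          have h := huR
          rw [div_le_iff₀ (by positivity)] at h
          linarith
        nlinarith [mul_nonneg hu0 (sub_nonneg.2 h1)]
      refine ⟨N₂, fun L₀ u v hu hv => ?_⟩
      have hu' : ρ * ((u : ℝ) + Real.sqrt u) ≤ u := by
        have h := hroot u hu
        have e : ρ * (k * (u : ℝ)) = (1 - ρ) * u := by rw [hk]; field_simp
        nlinarith [mul_le_mul_of_nonneg_left h hρ0.le]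
      have hv' : ρ * ((v : ℝ) + Real.sqrt v) ≤ v := by
        have h := hroot v hv
        have e : ρ * (k * (v : ℝ)) = (1 - ρ) * v := by rw [hk]; field_simp
        nlinarith [mul_le_mul_of_nonneg_left h hρ0.le]
      have hcast : (((u + L₀ + v : ℕ) : ℝ)) = (u : ℝ) + L₀ + v := by push_cast; ring
      have hL : (0 : ℝ) ≤ L₀ := Nat.cast_nonneg L₀
      have hsq : 0 ≤ Real.sqrt ((u + L₀ + v : ℕ) : ℝ) := Real.sqrt_nonneg _
      rw [hcast] at hsq ⊢
      linarith
  · -- `u = v = n²` with `n` large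
    obtain ⟨M, hM⟩ := exists_nat_ge (2 * (C + L₀) + 1)
    set n : ℕ := max (max N₂ L₀) (max 4 M) with hn
    have hn4 : 4 ≤ n := le_trans (le_max_left _ _) (le_max_right _ _)
    have hnN : N₂ ≤ n := le_trans (le_max_left _ _) (le_max_left _ _)
    have hnL : L₀ ≤ n := le_trans (le_max_right _ _) (le_max_left _ _)
    have hnM : M ≤ n := le_trans (le_max_right _ _) (le_max_right _ _)
    have hnR4 : (4 : ℝ) ≤ n := by exact_mod_cast hn4
    have hnRL : (L₀ : ℝ) ≤ n := by exact_mod_cast hnL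
    have hnRM : 2 * (C + L₀) + 1 ≤ n := le_trans hM (by exact_mod_cast hnM)
    have hn1 : 1 ≤ n := le_trans (by norm_num) hn4
    refine ⟨n ^ 2, n ^ 2, le_trans hnN (by nlinarith), le_trans hnN (by nlinarith), ?_⟩
    have hc1 : (((n ^ 2 : ℕ) : ℝ)) = (n : ℝ) ^ 2 := by push_cast; ring
    have hc2 : (((n ^ 2 + L₀ + n ^ 2 : ℕ) : ℝ)) = 2 * (n : ℝ) ^ 2 + L₀ := by push_cast; ring
    rw [hc1, hc2, Real.sqrt_sq (by positivity)]
    -- `√(2n² + L₀) ≤ 3n/2`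
    have hroot : Real.sqrt (2 * (n : ℝ) ^ 2 + L₀) ≤ 3 * n / 2 := by
      rw [Real.sqrt_le_iff]
      refine ⟨by positivity, ?_⟩
      nlinarith
    linarith

/-- **Corollary: `BufferedSeriesLaw`-shape is not forced by the necessary data.**  «`r_N/N → 1` and every ratio law `ρ < 1` (all buffers)
⟹ the buffered series inequality for some `C, L₀, N₂`» is FALSE at sequence level. [folklore] -/
theorem not_bufferedSeries_of_asymptoticRatio :
    ¬ ∀ r : ℕ → ℝ, Tendsto (fun N : ℕ => r N / N) atTop (𝓝 1) →
      (∀ ρ : ℝ, ρ < 1 → ∃ N₂ : ℕ, ∀ L₀ u v : ℕ, N₂ ≤ u → N₂ ≤ v → ρ * (r u + r v) ≤ r (u + L₀ + v)) →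
      ∃ (C : ℝ) (L₀ N₂ : ℕ), ∀ u v : ℕ, N₂ ≤ u → N₂ ≤ v → r u + r v - C ≤ r (u + L₀ + v) := by
  intro h
  obtain ⟨hlim, hlaw, hfail⟩ := sqrt_witness
  obtain ⟨C, L₀, N₂, hBSL⟩ := h (fun N => (N : ℝ) + Real.sqrt N) hlim hlaw
  obtain ⟨u, v, hu, hv, hlt⟩ := hfail C L₀ N₂
  exact absurd (hBSL u v hu hv) (not_le.2 hlt)

end EscapeGrading

end Summit.AtomisticToContinuum.FouriersLaw.Theorems.SubdiffusiveBondHeat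

end
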